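import Literature.Computability.AlgebraicComplexity.BD17DescartesSystemsWronskians
import Mathlib.Analysis.Calculus.IteratedDeriv.Lemmas
import Mathlib.Analysis.Calculus.ContDiff.Defs
import Mathlib.Analysis.Analytic.Constructions
import Mathlib.LinearAlgebra.Matrix.Block
import Mathlib.GroupTheory.Perm.Fin
import Mathlib.Order.Interval.Finset.Fin
import HarnessLib

/-!
# Wronskian identities (Pólya–Szegő VII 55–58) and the transform of Pólya–Szegő V 89

THEOREMS ONLY (no definitions, no named facts); first of three proof files discharging the named
fact `BD2017_prop_4_2` of `BD17DescartesSystemsWronskians.lean` (Bihan–Dickenstein 2017,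
Prop. 4.2 = Pólya–Szegő, *Problems and theorems in analysis* II, Part V, problems 87 and 90: a
sequence of real analytic functions on an open interval satisfies Descartes' rule of signs iff all
its Wronskians are nonvanishing and Wronskians of the same size have the same sign).

Source followed: G. Pólya, G. Szegő, *Problems and Theorems in Analysis II*, Springer (Classics in
Mathematics, 1998 printing; held text `book:polya1998-problems-theorems-analysis-ii-theory-functions-zeros`),
Part VII §5 problems 55, 57, 58 (p0134) and Part V §7 problem 89 with its solution (p0083, p0241).
This file provides, for the Wronskian `BD17.wronskian h y = det (h_j^{(i)}(y))`:

* `BD17.wronskian_congr_of_eqOn` — the Wronskian at `y ∈ Δ` (open) only depends on the functions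
  on `Δ`;
* `BD17.wronskian_comp_perm` — permuting the functions multiplies `W` by the sign of the
  permutation (columns of a determinant);
* `BD17.wronskian_const_mul` — VII 55 for diagonal constants: `W(c_1h_1,…,c_sh_s) = (∏ c_j) W(h)`;
* `BD17.wronskian_cons_one_eq_wronskian_deriv` — `W(1, u_1, …, u_ℓ) = W(u_1', …, u_ℓ')`
  (expansion along the first column);
* `BD17.wronskian_mul_left` — VII 57: `W(g·v_1, …, g·v_m) = g^m · W(v_1, …, v_m)` (Leibniz' rule
  makes the Wronskian matrix of the `g·v_b` a lower-triangular matrix with diagonal `g` times the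
  Wronskian matrix of the `v_b`);
* `BD17.wronskian_deriv_div_mul_pow` — VII 58 in the form used in V 89:
  `W((h_{i_1}/h_q)', …, (h_{i_ℓ}/h_q)') · h_q^{ℓ+1} = W(h_q, h_{i_1}, …, h_{i_ℓ})`;
* `BD17.exists_strictMono_wronskian_transform` — V 89: for
  `1 ≤ ν_1 < ⋯ < ν_j < α < ν_{j+1} < ⋯ < ν_l ≤ n`,
  `W(h_{ν_1},…,h_{ν_j},h_α,h_{ν_{j+1}},…,h_{ν_l}) = h_α^{l+1} W(−(h_{ν_1}/h_α)', …, −(h_{ν_j}/h_α)',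
  (h_{ν_{j+1}}/h_α)', …, (h_{ν_l}/h_α)')`, i.e. the Wronskians of increasing subfamilies of the
  transformed family `H_i = ∓(h_i/h_α)'` are, up to the nonzero factor `h_α^{l+1}`,
  Wronskians of increasing subfamilies (one larger) of the original family;
* `BD17.wronskian_fin_zero`, `BD17.wronskian_fin_one` — `W_0 = 1`, `W_1 = f_1` (VII 62).

Cell `val-lit`, row X4-BD17 (LADDER-VALIANT V1 ideation source). Honest framing: classical
calculus of determinants; nothing here bears on VP versus VNP.

## References

* [PolyaSzego1998] G. Pólya, G. Szegő, *Problems and Theorems in Analysis II*, Springer Classics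
  in Mathematics (1998 printing), doi:10.1007/978-3-642-61905-2: Part VII §5 problems 55, 57, 58, 62;
  Part V §7 problems 87–90 (solutions pp. 226–227).
* [BihanDickenstein2017] F. Bihan, A. Dickenstein, IMRN 2017 (22) 6867–6893; arXiv:1601.05826,
  §4.1 Prop. 4.2.
-/

noncomputable section

open Matrix Finset

namespace Literature.Computability.AlgebraicComplexity

namespace BD17

/-! ### The Wronskian as a determinant: congruence, permutations, constants -/

/-- The Wronskian at a point of an open set `Δ` only depends on the functions on `Δ`
(the setting of Def. 4.1: functions on an open interval). [cite: BihanDickenstein2017, Def. 4.1] -/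
theorem wronskian_congr_of_eqOn {s : ℕ} {h h' : Fin s → ℝ → ℝ} {Δ : Set ℝ} (hΔ : IsOpen Δ)
    (hh : ∀ j, Set.EqOn (h j) (h' j) Δ) {y : ℝ} (hy : y ∈ Δ) :
    wronskian h y = wronskian h' y := by
  unfold wronskian
  congr 1
  ext i j
  simp only [Matrix.of_apply]
  exact (hh j).iteratedDeriv_of_isOpen hΔ i.val hy

/-- Permuting the functions multiplies the Wronskian by the sign of the permutation (the
Wronskian is a determinant, [VII, §5]). [cite: PolyaSzego1998, Part VII §5 problem 55] -/
theorem wronskian_comp_perm {s : ℕ} (h : Fin s → ℝ → ℝ) (σ : Equiv.Perm (Fin s)) (y : ℝ) :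
    wronskian (fun j => h (σ j)) y = ((Equiv.Perm.sign σ : ℤ) : ℝ) * wronskian h y := by
  unfold wronskian
  rw [← Matrix.det_permute' σ]
  rfl

/-- **Pólya–Szegő VII 55** (diagonal case): `W(c_1 h_1, …, c_s h_s) = (∏ c_j) · W(h_1, …, h_s)`.
[cite: PolyaSzego1998, Part VII §5 problem 55] -/
theorem wronskian_const_mul {s : ℕ} (c : Fin s → ℝ) (h : Fin s → ℝ → ℝ) (y : ℝ) :
    wronskian (fun j z => c j * h j z) y = (∏ j, c j) * wronskian h y := by
  unfold wronskian
  rw [← Matrix.det_mul_row c]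
  congr 1
  ext i j
  simp only [Matrix.of_apply, iteratedDeriv_const_mul_field]

/-- A `1 × 1` Wronskian is the function itself (`W_1 = f_1`, [VII 62]).
[cite: PolyaSzego1998, Part VII §5 problem 62] -/
theorem wronskian_fin_one (h : Fin 1 → ℝ → ℝ) (y : ℝ) : wronskian h y = h 0 y := by
  unfold wronskian
  rw [Matrix.det_fin_one]
  simp

/-- A `0 × 0` Wronskian is `1` (`W_0 = 1`, [VII 62]). [cite: PolyaSzego1998, Part VII §5 problem 62] -/
theorem wronskian_fin_zero (h : Fin 0 → ℝ → ℝ) (y : ℝ) : wronskian h y = 1 := by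
  unfold wronskian
  exact Matrix.det_isEmpty

/-! ### `W(1, u_1, …, u_ℓ) = W(u_1', …, u_ℓ')` -/

/-- Expanding along the first column: `W(1, u_1, …, u_ℓ) = W(u_1', …, u_ℓ')` (the case `c = 1`
of VII 58). [cite: PolyaSzego1998, Part VII §5 problem 58] -/
theorem wronskian_cons_one_eq_wronskian_deriv {ℓ : ℕ} (u : Fin ℓ → ℝ → ℝ) (y : ℝ) :
    wronskian (Fin.cons (fun _ : ℝ => (1 : ℝ)) u : Fin (ℓ + 1) → ℝ → ℝ) y =
      wronskian (fun b => deriv (u b)) y := by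
  unfold wronskian
  rw [Matrix.det_succ_column_zero, Fin.sum_univ_succ]
  have h0 : ∀ i : Fin ℓ, (Matrix.of fun i j : Fin (ℓ + 1) =>
      iteratedDeriv i.val ((Fin.cons (fun _ : ℝ => (1 : ℝ)) u : Fin (ℓ + 1) → ℝ → ℝ) j) y)
        i.succ 0 = 0 := by
    intro i
    simp [iteratedDeriv_const]
  simp only [h0, mul_zero, zero_mul, Finset.sum_const_zero, add_zero]
  simp only [Matrix.of_apply, Fin.cons_zero, Fin.val_zero, iteratedDeriv_zero, pow_zero, one_mul]
  congr 1
  ext i b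
  simp [Matrix.submatrix_apply, iteratedDeriv_succ']

/-! ### Pólya–Szegő VII 57: `W(g v_1, …, g v_m) = g^m W(v_1, …, v_m)` -/

/-- Pólya–Szegő VII 57: `W(g·v_1, …, g·v_m)(y) = g(y)^m · W(v_1, …, v_m)(y)` for functions analytic
at `y` (Leibniz' rule: the Wronskian matrix of the products is a lower-triangular matrix with
diagonal entries `g(y)` times the Wronskian matrix of the `v_b`).
[cite: PolyaSzego1998, Part VII §5 problem 57] -/
theorem wronskian_mul_left {m : ℕ} (g : ℝ → ℝ) (v : Fin m → ℝ → ℝ) {y : ℝ}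
    (hg : AnalyticAt ℝ g y) (hv : ∀ b, AnalyticAt ℝ (v b) y) :
    wronskian (fun b z => g z * v b z) y = g y ^ m * wronskian v y := by
  classical
  set L : Matrix (Fin m) (Fin m) ℝ := Matrix.of fun i k : Fin m =>
    if k.val ≤ i.val then (i.val.choose k.val : ℝ) * iteratedDeriv (i.val - k.val) g y else 0
    with hL
  set V : Matrix (Fin m) (Fin m) ℝ := Matrix.of fun k b : Fin m => iteratedDeriv k.val (v b) y
    with hV
  have hW : (Matrix.of fun i b : Fin m => iteratedDeriv i.val (fun z => g z * v b z) y) = L * V := by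
    ext i b
    have hprod : (fun z => g z * v b z) = fun z => v b z * g z := by
      funext z; ring
    rw [Matrix.mul_apply, Matrix.of_apply, hprod,
      iteratedDeriv_fun_mul ((hv b).contDiffAt) (hg.contDiffAt)]
    have hrhs : ∑ k : Fin m, L i k * V k b =
        ∑ k : Fin m, (if k.val ≤ i.val then
          (i.val.choose k.val : ℝ) * iteratedDeriv k.val (v b) y *
            iteratedDeriv (i.val - k.val) g y else 0) := by
      refine Finset.sum_congr rfl fun k _ => ?_
      simp only [hL, hV, Matrix.of_apply]
      split_ifs <;> ring
    rw [hrhs, Fin.sum_univ_eq_sum_range (fun k => if k ≤ i.val then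
          (i.val.choose k : ℝ) * iteratedDeriv k (v b) y * iteratedDeriv (i.val - k) g y else 0) m,
      ← Finset.sum_filter]
    refine Finset.sum_congr ?_ fun k _ => rfl
    ext k
    simp only [Finset.mem_range, Finset.mem_filter]
    have := i.isLt
    omega
  have hLdet : L.det = g y ^ m := by
    rw [Matrix.det_of_lowerTriangular L]
    · simp [hL]
    · intro i j hij
      have hij' : i < j := by simpa using hij
      simp only [hL, Matrix.of_apply]
      rw [if_neg]
      exact not_le.mpr (Fin.lt_def.mp hij')
  unfold wronskian
  rw [hW, Matrix.det_mul, hLdet]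

/-! ### Pólya–Szegő VII 58 / V 89: dividing by `h_q` and differentiating -/

/-- Pólya–Szegő VII 57–58 as used in V 89: for `y` in an open set `Δ` on which `h_q` does not
vanish and all functions are analytic,
`W((h_{i_1}/h_q)', …, (h_{i_ℓ}/h_q)')(y) · h_q(y)^{ℓ+1} = W(h_q, h_{i_1}, …, h_{i_ℓ})(y)`.
[cite: PolyaSzego1998, Part VII §5 problem 58; Part V §7 solution 89] -/
theorem wronskian_deriv_div_mul_pow {s ℓ : ℕ} (h : Fin s → ℝ → ℝ) (q : Fin s) (I : Fin ℓ → Fin s)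
    {Δ : Set ℝ} (hΔ : IsOpen Δ) (hh : ∀ i, AnalyticOnNhd ℝ (h i) Δ) (hq : ∀ z ∈ Δ, h q z ≠ 0)
    {y : ℝ} (hy : y ∈ Δ) :
    wronskian (fun b => deriv (fun z => h (I b) z / h q z)) y * h q y ^ (ℓ + 1) =
      wronskian (Fin.cons (h q) (fun b => h (I b)) : Fin (ℓ + 1) → ℝ → ℝ) y := by
  set u : Fin ℓ → ℝ → ℝ := fun b z => h (I b) z / h q z with hu
  have hcons : ∀ c : Fin (ℓ + 1),
      Set.EqOn ((Fin.cons (h q) (fun b => h (I b)) : Fin (ℓ + 1) → ℝ → ℝ) c)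
        (fun z => h q z * (Fin.cons (fun _ : ℝ => (1 : ℝ)) u : Fin (ℓ + 1) → ℝ → ℝ) c z) Δ := by
    intro c
    refine Fin.cases ?_ (fun b => ?_) c
    · intro z _
      simp
    · intro z hz
      simp only [Fin.cons_succ, hu]
      field_simp [hq z hz]
  rw [wronskian_congr_of_eqOn hΔ hcons hy, wronskian_mul_left (h q) _ ((hh q) y hy),
    wronskian_cons_one_eq_wronskian_deriv]
  · ring
  · intro c
    refine Fin.cases ?_ (fun b => ?_) c
    · simpa using analyticAt_const
    · simp only [Fin.cons_succ, hu]
      exact ((hh (I b)) y hy).div ((hh q) y hy) (hq y hy)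

/-! ### Pólya–Szegő V 89: the transformed family and increasing subfamilies -/

/-- Inserting a value into a strictly increasing tuple at the position dictated by the order gives
a strictly increasing tuple. -/
@[folklore] private theorem strictMono_insertNth {ℓ : ℕ} {α : Type*} [LinearOrder α] (f : Fin ℓ → α)
    (hf : StrictMono f) (a : α) (P : Fin (ℓ + 1))
    (hlt : ∀ b : Fin ℓ, b.castSucc < P → f b < a) (hgt : ∀ b : Fin ℓ, P ≤ b.castSucc → a < f b) :
    StrictMono (P.insertNth a f : Fin (ℓ + 1) → α) := by
  intro x y hxy
  by_cases hx : x = P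
  · subst hx
    have hy : y ≠ x := ne_of_gt hxy
    obtain ⟨b, rfl⟩ := Fin.exists_succAbove_eq hy
    rw [Fin.insertNth_apply_same, Fin.insertNth_apply_succAbove]
    exact hgt b ((Fin.lt_succAbove_iff_le_castSucc x b).mp hxy)
  · obtain ⟨b, rfl⟩ := Fin.exists_succAbove_eq hx
    by_cases hy : y = P
    · subst hy
      rw [Fin.insertNth_apply_same, Fin.insertNth_apply_succAbove]
      exact hlt b ((Fin.succAbove_lt_iff_castSucc_lt y b).mp hxy)
    · obtain ⟨b', rfl⟩ := Fin.exists_succAbove_eq hy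
      rw [Fin.insertNth_apply_succAbove, Fin.insertNth_apply_succAbove]
      exact hf ((Fin.strictMono_succAbove P).lt_iff_lt.mp hxy)

/-- A downward closed subset of `Fin ℓ` is the initial segment of length its cardinality. -/
@[folklore] private theorem mem_iff_val_lt_card_of_lowerSet {ℓ : ℕ} (S : Finset (Fin ℓ))
    (hS : ∀ b b' : Fin ℓ, b' ≤ b → b ∈ S → b' ∈ S) (b : Fin ℓ) : b ∈ S ↔ b.val < S.card := by
  constructor
  · intro hb
    have hsub : Finset.Iic b ⊆ S := fun b' hb' => hS b b' (Finset.mem_Iic.mp hb') hb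
    have := Finset.card_le_card hsub
    rw [Fin.card_Iic] at this
    omega
  · intro hb
    by_contra hbS
    have hsub : S ⊆ Finset.Iio b := by
      intro b' hb'
      rw [Finset.mem_Iio]
      by_contra hle
      exact hbS (hS b' b (not_lt.mp hle) hb')
    have := Finset.card_le_card hsub
    rw [Fin.card_Iio] at this
    omega

/-- The product of the signs `∓1` of Pólya–Szegő V 89 over a subfamily. -/
@[folklore] private theorem prod_ite_neg_one_eq_pow {ℓ : ℕ} (p : Fin ℓ → Prop) [DecidablePred p] :
    (∏ b : Fin ℓ, (if p b then (-1 : ℝ) else 1)) = (-1) ^ (Finset.univ.filter p).card := by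
  rw [Finset.prod_ite, Finset.prod_const, Finset.prod_const_one, mul_one]

/-- **Pólya–Szegő V 89.** Let `h_0, …, h_t` be analytic on the open set `Δ` with `h_q ≠ 0` on `Δ`,
and let `H_j = ε_j · (h_{σ(j)}/h_q)'` (`j < t`), where `σ = q.succAbove` enumerates the indices
`≠ q` increasingly and `ε_j = −1` if `σ(j) < q`, `ε_j = +1` if `σ(j) > q`. Then for every strictly
increasing `J : [ℓ] → [t]` there is a strictly increasing `J⁺ : [ℓ+1] → [t+1]` (the indices
`σ(J(b))` together with `q`, sorted) with
`W(H_{J(0)}, …, H_{J(ℓ−1)})(y) · h_q(y)^{ℓ+1} = W(h_{J⁺(0)}, …, h_{J⁺(ℓ)})(y)` for all `y ∈ Δ`.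
[cite: PolyaSzego1998, Part V §7 problem 89] -/
theorem exists_strictMono_wronskian_transform {t ℓ : ℕ} (h : Fin (t + 1) → ℝ → ℝ)
    (q : Fin (t + 1)) {Δ : Set ℝ} (hΔ : IsOpen Δ) (hh : ∀ i, AnalyticOnNhd ℝ (h i) Δ)
    (hq : ∀ z ∈ Δ, h q z ≠ 0) (J : Fin ℓ → Fin t) (hJ : StrictMono J) :
    ∃ J' : Fin (ℓ + 1) → Fin (t + 1), StrictMono J' ∧ ∀ y ∈ Δ,
      wronskian (fun b => (fun (j : Fin t) (z : ℝ) =>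
          (if (Fin.castSucc j) < q then (-1 : ℝ) else 1) *
            deriv (fun z => h (q.succAbove j) z / h q z) z) (J b)) y * h q y ^ (ℓ + 1) =
        wronskian (fun c => h (J' c)) y := by
  classical
  -- the number `p` of indices of the subfamily below `q`
  set S : Finset (Fin ℓ) := Finset.univ.filter fun b => Fin.castSucc (J b) < q with hS
  have hSdown : ∀ b b' : Fin ℓ, b' ≤ b → b ∈ S → b' ∈ S := by
    intro b b' hb'b hb
    simp only [hS, Finset.mem_filter, Finset.mem_univ, true_and] at hb ⊢
    exact lt_of_le_of_lt (Fin.castSucc_le_castSucc_iff.mpr (hJ.monotone hb'b)) hb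
  have hmemS : ∀ b : Fin ℓ, Fin.castSucc (J b) < q ↔ b.val < S.card := by
    intro b
    rw [← mem_iff_val_lt_card_of_lowerSet S hSdown b]
    simp [hS]
  have hcard : S.card ≤ ℓ := by
    simpa using Finset.card_le_univ S
  set P : Fin (ℓ + 1) := ⟨S.card, Nat.lt_succ_of_le hcard⟩ with hP
  -- the sorted enumeration of `{q} ∪ σ(J)`
  set J' : Fin (ℓ + 1) → Fin (t + 1) := P.insertNth q (fun b => q.succAbove (J b)) with hJ'def
  have hJ'mono : StrictMono J' := by
    refine strictMono_insertNth (fun b => q.succAbove (J b))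
      (fun a b hab => (Fin.strictMono_succAbove q) (hJ hab)) q P ?_ ?_
    · intro b hb
      rw [Fin.succAbove_lt_iff_castSucc_lt]
      exact (hmemS b).mpr (by simpa [hP, Fin.lt_def] using hb)
    · intro b hb
      rw [Fin.lt_succAbove_iff_le_castSucc]
      have : ¬ b.val < S.card := by simpa [hP, Fin.le_def] using hb
      exact not_lt.mp (mt (hmemS b).mp this)
  refine ⟨J', hJ'mono, fun y hy => ?_⟩
  -- pull the signs out
  rw [wronskian_const_mul (fun b => if Fin.castSucc (J b) < q then (-1 : ℝ) else 1)
    (fun b => deriv (fun z => h (q.succAbove (J b)) z / h q z)) y]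
  rw [prod_ite_neg_one_eq_pow, mul_assoc,
    wronskian_deriv_div_mul_pow h q (fun b => q.succAbove (J b)) hΔ hh hq hy]
  -- `(h_q, h_{σJ(0)}, …) = (h ∘ J') ∘ (cycleRange P)⁻¹`
  have hfam : (Fin.cons (h q) (fun b => h (q.succAbove (J b))) : Fin (ℓ + 1) → ℝ → ℝ) =
      fun c => (fun c' => h (J' c')) ((Fin.cycleRange P).symm c) := by
    funext c
    have := congrFun (Fin.insertNth_comp_cycleRange_symm P q (fun b => q.succAbove (J b))) c
    simp only [Function.comp_apply] at this
    change _ = h (J' ((Fin.cycleRange P).symm c))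
    rw [hJ'def, this]
    refine Fin.cases ?_ (fun b => ?_) c <;> simp
  rw [hfam, wronskian_comp_perm (fun c' => h (J' c')) (Fin.cycleRange P).symm y,
    Equiv.Perm.sign_symm, Fin.sign_cycleRange]
  rw [← mul_assoc]
  convert one_mul (wronskian (fun c' => h (J' c')) y) using 2
  have hPval : (P : ℕ) = S.card := by rw [hP]
  rw [hPval]
  simp only [Units.val_pow_eq_pow_val, Units.val_neg, Units.val_one, Int.cast_pow, Int.cast_neg,
    Int.cast_one]
  rw [← mul_pow]
  norm_num

end BD17

end Literature.Computability.AlgebraicComplexity
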